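import Mathlib
import Summits.PneNP.PneNP.Theorems.CnfIdealGenLengthRankDefectRepresentationsStripCompletion
import Literature.Computability.AlgebraicComplexity.MultiplicativeComplexityCommutatorBound

/-!
# Crux `RankDefectRepresentations` (stmt-PneNP-18923), line `rank-dehn-ladder`: QUADRANT CAPTURE (registered stub
# `stub_quadrantCapture`, lead g14 RESHAPE 8; memo `Cruxes/RankDefectRepresentations/Lines/rank-dehn-ladder-g14.md` §2)

For a two-family instance `D` (rows and columns coloured by `{0,1}^n × {0,1}^{n'}`; a cell is VISIBLE iff the first-family colours differ AND
the second-family colours differ; `doubleCut row col A A' D` = the sum of the four rectangle ranks of `(A, A')`), at a MAXIMISER `(B, B')` of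
the double cut ONE matrix of rank `≤ 17 c` agrees with `D` on every visible cell that is separated by `B` (first family) or by `B'` (second
family) — so that only the four quadrant sub-instances `B^± × B'^±` remain (`stub_quadrantCapture`).

Proof.  (0) `doubleCut` is the sum of the four rectangle ranks (`doubleCut_eq_sum_four`; rank is additive over blocks in disjoint rows and
columns, `rank_add_of_disjoint`), so the second-family cut function of the first-family-masked matrix is again a double cut
(`cutJ_maskI_eq_doubleCut`).  (1) The `B'`-masked matrix
`maskJ row col B' D` is an honest first-family instance whose bipartition-cut function is `A ↦ doubleCut A B'`, maximised at `B`, so g7's max-cut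
decomposition (`exists_blockDiagonal_of_maxCut`, p642852) puts it within rank `4c` of a first-family block-diagonal matrix.  (2) Symmetrically
for the `B`-masked matrix with the second-family colouring (cut function `A' ↦ doubleCut B A'` by (0)).  (3) Combine the two low-rank parts with
the masks "second family separated" / "first family separated" (each a two-block pattern, so the rank at most doubles) and subtract the doubly
separated part of `D` (the four rectangles of `(B,B')`, rank `= doubleCut B B' ≤ c`): `8c + 8c + c`.
HONEST FRAMING: elementary negative-lane tool; the lead's stub `stub_merge` and the crux stay open; P ≠ NP is not moved; F-N2 is a FRONTIER
formal rung.
-/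

set_option linter.dupNamespace false -- `Summit.PneNP.PneNP.…`: summit = sub-problem name (D-0017)

namespace Summit.PneNP.PneNP.Theorems.CnfIdealGenLengthRankDefectRepresentationsQuadrantCapture

open Matrix Finset
open Summit.PneNP.PneNP.Theorems.CnfIdealGenLengthRankDefectRepresentationsMergeLowerBound (rank_add_le' rank_sub_le')
open Summit.PneNP.PneNP.Theorems.CnfIdealGenLengthRankDefectRepresentationsCutLemma (exists_blockDiagonal_of_maxCut)
open Summit.PneNP.PneNP.Theorems.CnfIdealGenLengthRankDefectRepresentationsCutLemmaMonotoneCuts (rank_pad_le)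
open Summit.PneNP.PneNP.Theorems.CnfIdealGenLengthRankDefectRepresentationsStripCompletion (rank_mask_le)
open Summit.PneNP.PneNP.Theorems.CnfIdealGenLengthRankDefectRepresentationsTwoFamilyCutDomination
  (colourI colourJ maskJ doubleCut)
open Literature.Computability.AlgebraicComplexity (rank_add_rank_le_rank_fromBlocks_diag)

variable {K : Type} [Field K]

/-! ## Rank is additive over blocks in disjoint rows and columns -/

section Disjoint

variable {ι ι' : Type} [Fintype ι] [Fintype ι'] [DecidableEq ι] [DecidableEq ι']

/-- **Rank additivity for blocks in disjoint rows and disjoint columns**: if `X` is supported on `P × Q` and `Y` on `Pᶜ × Qᶜ`, then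
`rank (X + Y) = rank X + rank Y` (after reindexing, `X + Y` is block-diagonal). [folklore] -/
theorem rank_add_of_disjoint (P : ι → Prop) (Q : ι' → Prop) [DecidablePred P] [DecidablePred Q] (X Y : Matrix ι ι' K)
    (hX : ∀ x y, ¬ (P x ∧ Q y) → X x y = 0) (hY : ∀ x y, ¬ (¬ P x ∧ ¬ Q y) → Y x y = 0) :
    (X + Y).rank = X.rank + Y.rank := by
  classical
  apply le_antisymm (rank_add_le' X Y)
  set X₁ : Matrix {x // P x} {y // Q y} K := X.submatrix Subtype.val Subtype.val with hX₁
  set Y₁ : Matrix {x // ¬ P x} {y // ¬ Q y} K := Y.submatrix Subtype.val Subtype.val with hY₁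
  -- `X` and `Y` are the zero-paddings of `X₁`, `Y₁`
  have eX : X = Matrix.of fun x y => if hx : P x then (if hy : Q y then X₁ ⟨x, hx⟩ ⟨y, hy⟩ else 0) else 0 := by
    ext x y
    by_cases hx : P x <;> by_cases hy : Q y
    · simp [hX₁, hx, hy]
    · simp only [Matrix.of_apply, dif_pos hx, dif_neg hy]; exact hX x y (fun h => hy h.2)
    · simp only [Matrix.of_apply, dif_neg hx]; exact hX x y (fun h => hx h.1)
    · simp only [Matrix.of_apply, dif_neg hx]; exact hX x y (fun h => hx h.1)
  have eY : Y = Matrix.of fun x y => if hx : ¬ P x then (if hy : ¬ Q y then Y₁ ⟨x, hx⟩ ⟨y, hy⟩ else 0) else 0 := by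
    ext x y
    by_cases hx : P x <;> by_cases hy : Q y
    · simp only [Matrix.of_apply, hx, not_true_eq_false, dif_neg, not_false_eq_true]; exact hY x y (fun h => h.1 hx)
    · simp only [Matrix.of_apply, hx, not_true_eq_false, dif_neg, not_false_eq_true]; exact hY x y (fun h => h.1 hx)
    · simp only [Matrix.of_apply, hx, hy, not_false_eq_true, dif_pos, not_true_eq_false, dif_neg]; exact hY x y (fun h => h.2 hy)
    · simp [hY₁, hx, hy]
  have rX : X.rank ≤ X₁.rank := by
    conv_lhs => rw [eX]
    exact rank_pad_le _ _ X₁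
  have rY : Y.rank ≤ Y₁.rank := by
    conv_lhs => rw [eY]
    exact rank_pad_le _ _ Y₁
  -- reindex `X + Y` into block-diagonal form
  have e : (X + Y).submatrix (Equiv.sumCompl P) (Equiv.sumCompl Q) = Matrix.fromBlocks X₁ 0 0 Y₁ := by
    ext a b
    rcases a with a | a <;> rcases b with b | b
    · simp only [Matrix.submatrix_apply, Equiv.sumCompl_apply_inl, Matrix.add_apply, Matrix.fromBlocks_apply₁₁, hX₁]
      rw [hY a.1 b.1 (fun h => h.1 a.2), add_zero]
    · simp only [Matrix.submatrix_apply, Equiv.sumCompl_apply_inl, Equiv.sumCompl_apply_inr, Matrix.add_apply,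
        Matrix.fromBlocks_apply₁₂, Matrix.zero_apply]
      rw [hX a.1 b.1 (fun h => b.2 h.2), hY a.1 b.1 (fun h => h.1 a.2), add_zero]
    · simp only [Matrix.submatrix_apply, Equiv.sumCompl_apply_inl, Equiv.sumCompl_apply_inr, Matrix.add_apply,
        Matrix.fromBlocks_apply₂₁, Matrix.zero_apply]
      rw [hX a.1 b.1 (fun h => a.2 h.1), hY a.1 b.1 (fun h => h.2 b.2), add_zero]
    · simp only [Matrix.submatrix_apply, Equiv.sumCompl_apply_inr, Matrix.add_apply, Matrix.fromBlocks_apply₂₂, hY₁]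
      rw [hX a.1 b.1 (fun h => a.2 h.1), zero_add]
  calc X.rank + Y.rank ≤ X₁.rank + Y₁.rank := Nat.add_le_add rX rY
    _ ≤ (Matrix.fromBlocks X₁ 0 0 Y₁).rank := rank_add_rank_le_rank_fromBlocks_diag X₁ Y₁
    _ = ((X + Y).submatrix (Equiv.sumCompl P) (Equiv.sumCompl Q)).rank := by rw [e]
    _ = (X + Y).rank := Matrix.rank_submatrix _ _ _

end Disjoint

/-! ## The double cut is the sum of the four rectangle ranks; symmetry under exchanging the families -/

section FourRectangles

variable {n n' : ℕ} {ι ι' : Type} [Fintype ι] [Fintype ι'] [DecidableEq ι] [DecidableEq ι']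
variable (row : ι → Fin n ⊕ Fin n' → Bool) (col : ι' → Fin n ⊕ Fin n' → Bool)

/-- The RECTANGLE matrix `R(s,t)`: entries whose row has (first colour ∈ B) = `s`, (second colour ∈ B') = `t` and whose column lies on
the opposite sides in both families; zero elsewhere. -/
def rect (B : Finset (Fin n → Bool)) (B' : Finset (Fin n' → Bool)) (s t : Bool) (D : Matrix ι ι' K) : Matrix ι ι' K :=
  Matrix.of fun x y =>
    if (decide (colourI (row x) ∈ B) = s ∧ decide (colourJ (row x) ∈ B') = t) ∧
        (decide (colourI (col y) ∈ B) = !s ∧ decide (colourJ (col y) ∈ B') = !t) then D x y else 0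

omit [Fintype ι] [Fintype ι'] [DecidableEq ι] [DecidableEq ι'] in
/-- Entries of a rectangle matrix. -/
theorem rect_apply (B : Finset (Fin n → Bool)) (B' : Finset (Fin n' → Bool)) (s t : Bool) (D : Matrix ι ι' K) (x : ι) (y : ι') :
    rect row col B B' s t D x y =
      if (decide (colourI (row x) ∈ B) = s ∧ decide (colourJ (row x) ∈ B') = t) ∧
          (decide (colourI (col y) ∈ B) = !s ∧ decide (colourJ (col y) ∈ B') = !t) then D x y else 0 := rfl

omit [Fintype ι] [Fintype ι'] [DecidableEq ι] [DecidableEq ι'] in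
/-- The first-family block `(I ∈ B) × (I ∉ B)` of the `B'`-masked matrix is the sum of the two rectangles `R(1,1) + R(1,0)`. -/
theorem blockI_maskJ_eq (B : Finset (Fin n → Bool)) (B' : Finset (Fin n' → Bool)) (D : Matrix ι ι' K) (s : Bool) :
    (Matrix.of fun x y => if decide (colourI (row x) ∈ B) = s ∧ decide (colourI (col y) ∈ B) = !s then maskJ row col B' D x y else 0)
      = rect row col B B' s true D + rect row col B B' s false D := by
  ext x y
  simp only [Matrix.of_apply, Matrix.add_apply, rect_apply, maskJ]
  cases hs : decide (colourI (row x) ∈ B) <;> cases hs' : decide (colourI (col y) ∈ B) <;>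
    cases ht : decide (colourJ (row x) ∈ B') <;> cases ht' : decide (colourJ (col y) ∈ B') <;> cases s <;>
    simp_all

omit [Fintype ι] [Fintype ι'] [DecidableEq ι] [DecidableEq ι'] in
/-- The second-family block `(J ∈ B') × (J ∉ B')` of the `B`-masked matrix is the sum of the two rectangles `R(1,1) + R(0,1)`. -/
theorem blockJ_maskI_eq (B : Finset (Fin n → Bool)) (B' : Finset (Fin n' → Bool)) (D : Matrix ι ι' K) (t : Bool) :
    (Matrix.of fun x y => if decide (colourJ (row x) ∈ B') = t ∧ decide (colourJ (col y) ∈ B') = !t then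
        (Matrix.of fun x y => if (colourI (row x) ∈ B) ≠ (colourI (col y) ∈ B) then D x y else (0 : K)) x y else 0)
      = rect row col B B' true t D + rect row col B B' false t D := by
  ext x y
  simp only [Matrix.of_apply, Matrix.add_apply, rect_apply]
  cases hs : decide (colourI (row x) ∈ B) <;> cases hs' : decide (colourI (col y) ∈ B) <;>
    cases ht : decide (colourJ (row x) ∈ B') <;> cases ht' : decide (colourJ (col y) ∈ B') <;> cases t <;>
    simp_all

/-- Two rectangles with the same first side and opposite second sides occupy disjoint rows and disjoint columns: ranks add. -/
theorem rank_rect_add_rect_I (B : Finset (Fin n → Bool)) (B' : Finset (Fin n' → Bool)) (D : Matrix ι ι' K) (s : Bool) :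
    (rect row col B B' s true D + rect row col B B' s false D).rank =
      (rect row col B B' s true D).rank + (rect row col B B' s false D).rank := by
  refine rank_add_of_disjoint (fun x => decide (colourJ (row x) ∈ B') = true) (fun y => decide (colourJ (col y) ∈ B') = false) _ _ ?_ ?_
  · intro x y h
    rw [rect_apply, if_neg]
    rintro ⟨⟨-, h1⟩, -, h2⟩
    exact h ⟨h1, by simpa using h2⟩
  · intro x y h
    rw [rect_apply, if_neg]
    rintro ⟨⟨-, h1⟩, -, h2⟩
    apply h
    constructor
    · rw [h1]; decide
    · simp only [Bool.not_false] at h2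
      rw [h2]; decide

/-- Two rectangles with the same second side and opposite first sides occupy disjoint rows and disjoint columns: ranks add. -/
theorem rank_rect_add_rect_J (B : Finset (Fin n → Bool)) (B' : Finset (Fin n' → Bool)) (D : Matrix ι ι' K) (t : Bool) :
    (rect row col B B' true t D + rect row col B B' false t D).rank =
      (rect row col B B' true t D).rank + (rect row col B B' false t D).rank := by
  refine rank_add_of_disjoint (fun x => decide (colourI (row x) ∈ B) = true) (fun y => decide (colourI (col y) ∈ B) = false) _ _ ?_ ?_
  · intro x y h
    rw [rect_apply, if_neg]
    rintro ⟨⟨h1, -⟩, h2, -⟩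
    exact h ⟨h1, by simpa using h2⟩
  · intro x y h
    rw [rect_apply, if_neg]
    rintro ⟨⟨h1, -⟩, h2, -⟩
    apply h
    constructor
    · rw [h1]; decide
    · simp only [Bool.not_false] at h2
      rw [h2]; decide

omit [Fintype ι] [DecidableEq ι] [DecidableEq ι'] in
/-- The two first-family blocks in the definition of `doubleCut`, rewritten with `decide`. -/
theorem doubleCut_eq_blocks (B : Finset (Fin n → Bool)) (B' : Finset (Fin n' → Bool)) (D : Matrix ι ι' K) :
    doubleCut row col B B' D =
      (Matrix.of fun x y => if decide (colourI (row x) ∈ B) = true ∧ decide (colourI (col y) ∈ B) = !true then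
          maskJ row col B' D x y else 0).rank +
      (Matrix.of fun x y => if decide (colourI (row x) ∈ B) = false ∧ decide (colourI (col y) ∈ B) = !false then
          maskJ row col B' D x y else 0).rank := by
  unfold doubleCut
  congr 3
  · ext x y; simp only [Bool.not_true, decide_eq_true_eq, decide_eq_false_iff_not]
  · ext x y; simp only [Bool.not_false, decide_eq_true_eq, decide_eq_false_iff_not]

/-- **The double cut is the sum of the four rectangle ranks.** -/
theorem doubleCut_eq_sum_four (B : Finset (Fin n → Bool)) (B' : Finset (Fin n' → Bool)) (D : Matrix ι ι' K) :
    doubleCut row col B B' D =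
      (rect row col B B' true true D).rank + (rect row col B B' true false D).rank +
      ((rect row col B B' false true D).rank + (rect row col B B' false false D).rank) := by
  rw [doubleCut_eq_blocks, blockI_maskJ_eq, blockI_maskJ_eq, rank_rect_add_rect_I, rank_rect_add_rect_I]

/-- **The second-family bipartition cut of the `B`-masked matrix is the double cut** `doubleCut B A'` (both are the four-rectangle sum). -/
theorem cutJ_maskI_eq_doubleCut (B : Finset (Fin n → Bool)) (A' : Finset (Fin n' → Bool)) (D : Matrix ι ι' K) :
    (Matrix.of fun x y => if colourJ (row x) ∈ A' ∧ colourJ (col y) ∉ A' then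
        (Matrix.of fun x y => if (colourI (row x) ∈ B) ≠ (colourI (col y) ∈ B) then D x y else (0 : K)) x y else 0).rank +
    (Matrix.of fun x y => if colourJ (row x) ∉ A' ∧ colourJ (col y) ∈ A' then
        (Matrix.of fun x y => if (colourI (row x) ∈ B) ≠ (colourI (col y) ∈ B) then D x y else (0 : K)) x y else 0).rank
      = doubleCut row col B A' D := by
  have e1 : (Matrix.of fun x y => if colourJ (row x) ∈ A' ∧ colourJ (col y) ∉ A' then
        (Matrix.of fun x y => if (colourI (row x) ∈ B) ≠ (colourI (col y) ∈ B) then D x y else (0 : K)) x y else 0) =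
      (Matrix.of fun x y => if decide (colourJ (row x) ∈ A') = true ∧ decide (colourJ (col y) ∈ A') = !true then
        (Matrix.of fun x y => if (colourI (row x) ∈ B) ≠ (colourI (col y) ∈ B) then D x y else (0 : K)) x y else 0) := by
    ext x y; simp only [Matrix.of_apply, Bool.not_true, decide_eq_true_eq, decide_eq_false_iff_not]
  have e2 : (Matrix.of fun x y => if colourJ (row x) ∉ A' ∧ colourJ (col y) ∈ A' then
        (Matrix.of fun x y => if (colourI (row x) ∈ B) ≠ (colourI (col y) ∈ B) then D x y else (0 : K)) x y else 0) =
      (Matrix.of fun x y => if decide (colourJ (row x) ∈ A') = false ∧ decide (colourJ (col y) ∈ A') = !false then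
        (Matrix.of fun x y => if (colourI (row x) ∈ B) ≠ (colourI (col y) ∈ B) then D x y else (0 : K)) x y else 0) := by
    ext x y; simp only [Matrix.of_apply, Bool.not_false, decide_eq_true_eq, decide_eq_false_iff_not]
  rw [e1, e2, blockJ_maskI_eq, blockJ_maskI_eq, rank_rect_add_rect_J, rank_rect_add_rect_J, doubleCut_eq_sum_four]
  ring

end FourRectangles

/-! ## Two-block masks at most double the rank -/

section Masks

variable {ι ι' : Type} [Fintype ι] [Fintype ι'] [DecidableEq ι] [DecidableEq ι']

/-- A "sides differ" mask is a sum of two product masks, so it at most doubles the rank. [folklore] -/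
theorem rank_sepMask_le (p : ι → Prop) (q : ι' → Prop) [DecidablePred p] [DecidablePred q] (L : Matrix ι ι' K) :
    (Matrix.of fun x y => if (p x) ≠ (q y) then L x y else 0).rank ≤ 2 * L.rank := by
  have e : (Matrix.of fun x y => if (p x) ≠ (q y) then L x y else 0) =
      (Matrix.of fun x y => if p x ∧ ¬ q y then L x y else 0) + (Matrix.of fun x y => if ¬ p x ∧ q y then L x y else 0) := by
    ext x y
    simp only [Matrix.of_apply, Matrix.add_apply]
    by_cases h1 : p x <;> by_cases h2 : q y <;> simp [h1, h2]
  rw [e, two_mul]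
  exact (rank_add_le' _ _).trans (Nat.add_le_add (rank_mask_le _ _ L) (rank_mask_le _ _ L))

end Masks

/-! ## The registered stub -/

/-- **QUADRANT CAPTURE** (registered stub `stub_quadrantCapture` of `Cruxes/RankDefectRepresentations/Lines/rank_dehn_ladder.lean`, lead g14
RESHAPE 8): at a maximiser `(B, B')` of the double cut, one matrix of rank `≤ 17c` agrees with `D` on every visible cell separated by `B` or by
`B'`. -/
theorem stub_quadrantCapture :
    ∀ (K : Type) [Field K] (n n' : ℕ) (ι ι' : Type) [Fintype ι] [Fintype ι'] [DecidableEq ι] [DecidableEq ι']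
      (row : ι → Fin n ⊕ Fin n' → Bool) (col : ι' → Fin n ⊕ Fin n' → Bool) (D : Matrix ι ι' K) (c : ℕ)
      (B : Finset (Fin n → Bool)) (B' : Finset (Fin n' → Bool)),
      (∀ A A', Summit.PneNP.PneNP.Theorems.CnfIdealGenLengthRankDefectRepresentationsTwoFamilyCutDomination.doubleCut row col A A' D ≤
        Summit.PneNP.PneNP.Theorems.CnfIdealGenLengthRankDefectRepresentationsTwoFamilyCutDomination.doubleCut row col B B' D) →
      Summit.PneNP.PneNP.Theorems.CnfIdealGenLengthRankDefectRepresentationsTwoFamilyCutDomination.doubleCut row col B B' D ≤ c →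
      ∃ N : Matrix ι ι' K, N.rank ≤ 17 * c ∧
        ∀ x y,
          Summit.PneNP.PneNP.Theorems.CnfIdealGenLengthRankDefectRepresentationsTwoFamilyCutDomination.colourI (row x) ≠
            Summit.PneNP.PneNP.Theorems.CnfIdealGenLengthRankDefectRepresentationsTwoFamilyCutDomination.colourI (col y) →
          Summit.PneNP.PneNP.Theorems.CnfIdealGenLengthRankDefectRepresentationsTwoFamilyCutDomination.colourJ (row x) ≠
            Summit.PneNP.PneNP.Theorems.CnfIdealGenLengthRankDefectRepresentationsTwoFamilyCutDomination.colourJ (col y) →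
          ((Summit.PneNP.PneNP.Theorems.CnfIdealGenLengthRankDefectRepresentationsTwoFamilyCutDomination.colourI (row x) ∈ B) ≠
              (Summit.PneNP.PneNP.Theorems.CnfIdealGenLengthRankDefectRepresentationsTwoFamilyCutDomination.colourI (col y) ∈ B) ∨
            (Summit.PneNP.PneNP.Theorems.CnfIdealGenLengthRankDefectRepresentationsTwoFamilyCutDomination.colourJ (row x) ∈ B') ≠
              (Summit.PneNP.PneNP.Theorems.CnfIdealGenLengthRankDefectRepresentationsTwoFamilyCutDomination.colourJ (col y) ∈ B')) →
          N x y = D x y := by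
  intro K _ n n' ι ι' _ _ _ _ row col D c B B' hmax hc
  classical
  -- (1) the `B'`-masked matrix, first-family coloured
  set M₁ : Matrix ι ι' K := maskJ row col B' D with hM₁
  have hmax₁ : ∀ A : Finset (Fin n → Bool),
      (Matrix.of fun x y => if colourI (row x) ∈ A ∧ colourI (col y) ∉ A then M₁ x y else 0).rank +
        (Matrix.of fun x y => if colourI (row x) ∉ A ∧ colourI (col y) ∈ A then M₁ x y else 0).rank ≤
      (Matrix.of fun x y => if colourI (row x) ∈ B ∧ colourI (col y) ∉ B then M₁ x y else 0).rank +
        (Matrix.of fun x y => if colourI (row x) ∉ B ∧ colourI (col y) ∈ B then M₁ x y else 0).rank :=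
    fun A => hmax A B'
  obtain ⟨R₁, hR₁, hL₁⟩ := exists_blockDiagonal_of_maxCut (fun x => colourI (row x)) (fun y => colourI (col y)) M₁ B hmax₁
  have hL₁c : (M₁ - R₁).rank ≤ 4 * c := hL₁.trans (Nat.mul_le_mul_left 4 hc)
  -- (2) the `B`-masked matrix, second-family coloured
  set M₂ : Matrix ι ι' K := Matrix.of fun x y => if (colourI (row x) ∈ B) ≠ (colourI (col y) ∈ B) then D x y else 0 with hM₂
  have hmax₂ : ∀ A' : Finset (Fin n' → Bool),
      (Matrix.of fun x y => if colourJ (row x) ∈ A' ∧ colourJ (col y) ∉ A' then M₂ x y else 0).rank +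
        (Matrix.of fun x y => if colourJ (row x) ∉ A' ∧ colourJ (col y) ∈ A' then M₂ x y else 0).rank ≤
      (Matrix.of fun x y => if colourJ (row x) ∈ B' ∧ colourJ (col y) ∉ B' then M₂ x y else 0).rank +
        (Matrix.of fun x y => if colourJ (row x) ∉ B' ∧ colourJ (col y) ∈ B' then M₂ x y else 0).rank := by
    intro A'
    rw [hM₂, cutJ_maskI_eq_doubleCut, cutJ_maskI_eq_doubleCut]
    exact hmax B A'
  obtain ⟨R₂, hR₂, hL₂⟩ := exists_blockDiagonal_of_maxCut (fun x => colourJ (row x)) (fun y => colourJ (col y)) M₂ B' hmax₂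
  have hL₂c : (M₂ - R₂).rank ≤ 4 * c := by
    rw [hM₂, cutJ_maskI_eq_doubleCut] at hL₂
    exact hL₂.trans (Nat.mul_le_mul_left 4 hc)
  -- (3) combine
  set L₁ : Matrix ι ι' K := M₁ - R₁ with hL₁def
  set L₂ : Matrix ι ι' K := M₂ - R₂ with hL₂def
  set N₁ : Matrix ι ι' K := Matrix.of fun x y => if (colourJ (row x) ∈ B') ≠ (colourJ (col y) ∈ B') then L₁ x y else 0 with hN₁
  set N₂ : Matrix ι ι' K := Matrix.of fun x y => if (colourI (row x) ∈ B) ≠ (colourI (col y) ∈ B) then L₂ x y else 0 with hN₂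
  set N₃ : Matrix ι ι' K := Matrix.of fun x y => if (colourI (row x) ∈ B) ≠ (colourI (col y) ∈ B) then M₁ x y else 0 with hN₃def
  -- the doubly separated part of `D` has rank `doubleCut B B'`
  have hN₃r : N₃.rank ≤ c := by
    have e : N₃ = (Matrix.of fun x y => if colourI (row x) ∈ B ∧ colourI (col y) ∉ B then M₁ x y else 0) +
        (Matrix.of fun x y => if colourI (row x) ∉ B ∧ colourI (col y) ∈ B then M₁ x y else 0) := by
      ext x y
      simp only [hN₃def, Matrix.of_apply, Matrix.add_apply]
      by_cases h1 : colourI (row x) ∈ B <;> by_cases h2 : colourI (col y) ∈ B <;> simp [h1, h2]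
    rw [e]
    refine (rank_add_le' _ _).trans ?_
    exact hc
  refine ⟨N₁ + N₂ - N₃, ?_, ?_⟩
  · calc (N₁ + N₂ - N₃).rank ≤ (N₁ + N₂).rank + N₃.rank := rank_sub_le' _ _
      _ ≤ N₁.rank + N₂.rank + N₃.rank := Nat.add_le_add_right (rank_add_le' _ _) _
      _ ≤ 2 * (4 * c) + 2 * (4 * c) + c := by
        refine Nat.add_le_add (Nat.add_le_add ?_ ?_) hN₃r
        · exact (rank_sepMask_le _ _ L₁).trans (Nat.mul_le_mul_left 2 hL₁c)
        · exact (rank_sepMask_le _ _ L₂).trans (Nat.mul_le_mul_left 2 hL₂c)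
      _ = 17 * c := by ring
  · intro x y hI hJ hsep
    have hI' : (fun x => colourI (row x)) x ≠ (fun y => colourI (col y)) y := hI
    have hJ' : (fun x => colourJ (row x)) x ≠ (fun y => colourJ (col y)) y := hJ
    have r1 : R₁ x y = 0 := hR₁ x y hI'
    have r2 : R₂ x y = 0 := hR₂ x y hJ'
    have m1 : M₁ x y = if (colourJ (row x) ∈ B') ≠ (colourJ (col y) ∈ B') then D x y else 0 := rfl
    have m2 : M₂ x y = if (colourI (row x) ∈ B) ≠ (colourI (col y) ∈ B) then D x y else 0 := rfl
    simp only [Matrix.sub_apply, Matrix.add_apply, hN₁, hN₂, hN₃def, Matrix.of_apply, hL₁def, hL₂def, r1, r2, sub_zero, m1, m2]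
    rcases hsep with h | h
    · by_cases h' : (colourJ (row x) ∈ B') ≠ (colourJ (col y) ∈ B')
      · simp [h, h']
      · simp [h, h']
    · by_cases h' : (colourI (row x) ∈ B) ≠ (colourI (col y) ∈ B)
      · simp [h, h']
      · simp [h, h']

end Summit.PneNP.PneNP.Theorems.CnfIdealGenLengthRankDefectRepresentationsQuadrantCapture
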